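import Literature.Computability.AlgebraicComplexity.PermanentBooleanSum
import HarnessLib

/-!
# Valiant's junctions all at once: one integer matrix for the whole Boolean sum (Valiant 1979, Lemma 3.1, second half)

`PermanentBooleanSum.lean` proves Bürgisser–Clausen–Shokrollahi 1997, Thm. (21.29) (Valiant's
junction/track step) ONE variable at a time: for a matrix `A` over `k ∪ X ∪ {Y_0, …, Y_t}` with at
most one variable per column, `per (gadget A ε) = ε · 16^μ · (per A(Y₀ := 0) + per A(Y₀ := 1))`
(`permanent_gadgetM`), `μ` the number of occurrences of `Y₀`; iterating and choosing
`ε = 16^{-μ}` gives Thm. (21.29). For the `#P`-hardness of the INTEGER permanent (Valiant 1979,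
Lemma 3.1: `Perm f(F) = 4^{t(F)} s(F)` with an integer matrix `f(F)`) one takes `ε = 1` and
keeps the factor `16^{occ}`; and for a polynomial-time many-one reduction one needs the iterated
matrix in CLOSED FORM. This file defines that closed form and proves it correct:

* `ValiantAll.Occ A` — the occurrences `(r, s)` of `Y`-variables in `A`; `Occ.var`; the order
  predicates `IsFirst`, `IsLast`, `IsNext` (by column index among the occurrences of the same
  variable — under the column property distinct occurrences of a variable have distinct columns);
* `ValiantAll.allAtOnce A` — the matrix over `k ∪ X` on
  `AIdx A = Fin N ⊕ (Occ A × (Fin 4 ⊕ Fin 4)) ⊕ Fin t`: the original block with all `Y := 0`; for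
  every occurrence `o` the rows/columns `L_{o,1..4}`, `R_{o,1..4}` carrying two copies of the
  Valiant matrix `V`, the unit links `(L_{o1}, L_{next o,4})` (resp. `(L_{o1}, c_{var o})` for the
  last occurrence), `(L_{o4}, R_{o1})`, `(R_{o1}, col o)`, `(R_{o4}, L_{o1})`, the column `R_{o4}`
  carrying the column of `o` with `Y_{var o} := 1` (other `Y := 0`); and one control index `c_v`
  per variable with `1` at `(c_v, c_v)` and at `(c_v, L_{first v,4})` — the transcription of
  `gadget A 1` with "`j + 1`", "`j + 1 = μ`", "`j = 0`" replaced by `IsNext`, `IsLast`, `IsFirst`;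
* `ValiantAll.perY_allAtOnce` — if `A` has the column property and every variable occurs,
  `per (allAtOnce A) = 16^{#Occ A} · ∑_{e ∈ {0,1}^t} per A(Y := e)` in `k[X]` (`perY M` is the
  permanent of `M.map entryVal`, i.e. `entryPer` on an arbitrary index type).

The proof is a bisimulation with the one-variable gadget: `allAtOnce A` is, up to an explicit
re-indexing `Φ`, `allAtOnce (gB A)` where `gB A` is `gadget A 1` re-indexed to `Fin` (the
occurrences of `Y₀` become the gadget's blocks, in the same column order as `yCol`; the other
occurrences and their order predicates are unchanged), so `per (allAtOnce A) = per (allAtOnce (gB A))`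
and induction on `t` with `permanent_gadgetM` concludes.

## References

* L. G. Valiant, *The complexity of computing the permanent*, Theoret. Comput. Sci. 8 (1979)
  189–201, Lemma 3.1 (p. 193; proof pp. 194–196: tracks, interchanges, junctions, "any good route
  contributes exactly `4^{t(F)}`").
* P. Bürgisser, M. Clausen, M. A. Shokrollahi, *Algebraic Complexity Theory*, Springer 1997,
  Thm. (21.29) and its proof, pp. 558–563 (the blocks `A'[i]` for all variables at once).
-/

noncomputable section

open MvPolynomial Matrix Finset

namespace Literature.Computability.AlgebraicComplexity

namespace ValiantAll

universe u v

variable {k : Type u} {σ : Type v}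

/-! ### Occurrences of `Y`-variables -/

section Occurrences

variable {t N : ℕ}

/-- The `Y`-variable of an entry of a matrix over `k ∪ X ∪ Y`, if it is one. [cite: BurgisserClausenShokrollahi1997, Thm. (21.29)] -/
def yvar : k ⊕ (σ ⊕ Fin t) → Option (Fin t)
  | Sum.inr (Sum.inr j) => some j
  | _ => none

/-- `yvar x = some j` iff `x` is the variable `Y_j`. [cite: BurgisserClausenShokrollahi1997, Thm. (21.29)] -/
theorem yvar_eq_some_iff (x : k ⊕ (σ ⊕ Fin t)) (j : Fin t) :
    yvar x = some j ↔ x = Sum.inr (Sum.inr j) := by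
  rcases x with c | i | j' <;> simp [yvar]

/-- `yvar x` is defined iff `x` is some `Y_j`. [cite: BurgisserClausenShokrollahi1997, Thm. (21.29)] -/
theorem isSome_yvar_iff (x : k ⊕ (σ ⊕ Fin t)) :
    (yvar x).isSome = true ↔ ∃ j, x = Sum.inr (Sum.inr j) := by
  rcases x with c | i | j' <;> simp [yvar]

variable (A : Matrix (Fin N) (Fin N) (k ⊕ (σ ⊕ Fin t)))

/-- The occurrences of `Y`-variables in `A`: positions `(r, s)` with `A r s = Y_j` for some `j`. [cite: BurgisserClausenShokrollahi1997, Thm. (21.29)] -/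
abbrev Occ : Type := {p : Fin N × Fin N // (yvar (A p.1 p.2)).isSome = true}

/-- The variable of an occurrence. [cite: BurgisserClausenShokrollahi1997, Thm. (21.29)] -/
def Occ.var (o : Occ A) : Fin t := (yvar (A o.1.1 o.1.2)).get o.2

/-- The entry at an occurrence is its variable. [cite: BurgisserClausenShokrollahi1997, Thm. (21.29)] -/
theorem Occ.entry (o : Occ A) : A o.1.1 o.1.2 = Sum.inr (Sum.inr o.var) := by
  rw [← yvar_eq_some_iff, Occ.var, Option.some_get]

/-- The occurrence at a position holding `Y_j`. [cite: BurgisserClausenShokrollahi1997, Thm. (21.29)] -/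
def Occ.mk' (r s : Fin N) (j : Fin t) (h : A r s = Sum.inr (Sum.inr j)) : Occ A :=
  ⟨(r, s), (isSome_yvar_iff _).2 ⟨j, h⟩⟩

/-- An occurrence with variable `j` at `(r, s)` means `A r s = Y_j`. [cite: BurgisserClausenShokrollahi1997, Thm. (21.29)] -/
theorem Occ.var_eq_iff (o : Occ A) (j : Fin t) : o.var = j ↔ A o.1.1 o.1.2 = Sum.inr (Sum.inr j) := by
  rw [o.entry]; simp

/-- The variable of `Occ.mk'`. [cite: BurgisserClausenShokrollahi1997, Thm. (21.29)] -/
@[simp] theorem Occ.var_mk' (r s : Fin N) (j : Fin t) (h : A r s = Sum.inr (Sum.inr j)) :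
    (Occ.mk' A r s j h).var = j :=
  (Occ.var_eq_iff A _ j).2 h

/-- Under the column property, an occurrence is determined by its column. [cite: BurgisserClausenShokrollahi1997, Thm. (21.29)] -/
theorem Occ.eq_of_col_eq (hA : HasColumnProperty A) {o o' : Occ A} (h : o.1.2 = o'.1.2) : o = o' := by
  have hr : o.1.1 = o'.1.1 := hA o.1.2 _ _ (by rw [o.entry]; rfl) (by rw [h, o'.entry]; rfl)
  exact Subtype.ext (Prod.ext hr h)

/-- `o` is the FIRST occurrence of its variable (least column). [cite: BurgisserClausenShokrollahi1997, Thm. (21.29)] -/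
def IsFirst (o : Occ A) : Prop := ∀ o' : Occ A, o'.var = o.var → o.1.2 ≤ o'.1.2

/-- `o` is the LAST occurrence of its variable (greatest column). [cite: BurgisserClausenShokrollahi1997, Thm. (21.29)] -/
def IsLast (o : Occ A) : Prop := ∀ o' : Occ A, o'.var = o.var → o'.1.2 ≤ o.1.2

/-- `o'` is the NEXT occurrence of the variable of `o` (least column after the column of `o`). [cite: BurgisserClausenShokrollahi1997, Thm. (21.29)] -/
def IsNext (o o' : Occ A) : Prop :=
  o'.var = o.var ∧ o.1.2 < o'.1.2 ∧ ∀ o'' : Occ A, o''.var = o.var → o.1.2 < o''.1.2 → o'.1.2 ≤ o''.1.2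

/-- `IsFirst` is decidable (a finite conjunction). [folklore] -/
instance (o : Occ A) : Decidable (IsFirst A o) := by unfold IsFirst; infer_instance
/-- `IsLast` is decidable (a finite conjunction). [folklore] -/
instance (o : Occ A) : Decidable (IsLast A o) := by unfold IsLast; infer_instance
/-- `IsNext` is decidable (a finite conjunction). [folklore] -/
instance (o o' : Occ A) : Decidable (IsNext A o o') := by unfold IsNext; infer_instance

end Occurrences

/-! ### The all-at-once matrix -/

section Matrix

variable [CommRing k] {t N : ℕ} (A : Matrix (Fin N) (Fin N) (k ⊕ (σ ⊕ Fin t)))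

/-- The index type of the all-at-once matrix: original indices, eight new indices
`L_{o,1..4}, R_{o,1..4}` per occurrence `o`, one control index per variable. [cite: BurgisserClausenShokrollahi1997, Thm. (21.29)] -/
abbrev AIdx : Type := Fin N ⊕ ((Occ A × (Fin 4 ⊕ Fin 4)) ⊕ Fin t)

/-- **Valiant's construction for all variables at once** (BCS 1997, proof of Thm. (21.29), the
blocks `A'[i]`, with `ε = 1`): see the module docstring for the table of entries. [cite: BurgisserClausenShokrollahi1997, Thm. (21.29)] -/
def allAtOnce : Matrix (AIdx A) (AIdx A) (k ⊕ σ) := fun x y =>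
  match x, y with
  | Sum.inl r, Sum.inl s => boolSubstEntry (fun _ => false) (A r s)
  | Sum.inl r, Sum.inr (Sum.inl (o, Sum.inr p)) =>
      if p = 3 then boolSubstEntry (fun j => decide (j = o.var)) (A r o.1.2) else Sum.inl 0
  | Sum.inl _, Sum.inr (Sum.inl (_, Sum.inl _)) => Sum.inl 0
  | Sum.inl _, Sum.inr (Sum.inr _) => Sum.inl 0
  | Sum.inr (Sum.inl (o, Sum.inl p)), Sum.inr (Sum.inl (o', Sum.inl p')) =>
      if o = o' then Sum.inl (valiantV p p')
      else if p = 0 ∧ p' = 3 ∧ IsNext A o o' then Sum.inl 1 else Sum.inl 0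
  | Sum.inr (Sum.inl (o, Sum.inl p)), Sum.inr (Sum.inr v) =>
      if p = 0 ∧ IsLast A o ∧ o.var = v then Sum.inl 1 else Sum.inl 0
  | Sum.inr (Sum.inl (o, Sum.inl p)), Sum.inr (Sum.inl (o', Sum.inr p')) =>
      if o = o' ∧ p = 3 ∧ p' = 0 then Sum.inl 1 else Sum.inl 0
  | Sum.inr (Sum.inl (_, Sum.inl _)), Sum.inl _ => Sum.inl 0
  | Sum.inr (Sum.inl (o, Sum.inr p)), Sum.inr (Sum.inl (o', Sum.inr p')) =>
      if o = o' then Sum.inl (valiantV p p') else Sum.inl 0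
  | Sum.inr (Sum.inl (o, Sum.inr p)), Sum.inl s =>
      if p = 0 ∧ s = o.1.2 then Sum.inl 1 else Sum.inl 0
  | Sum.inr (Sum.inl (o, Sum.inr p)), Sum.inr (Sum.inl (o', Sum.inl p')) =>
      if o = o' ∧ p = 3 ∧ p' = 0 then Sum.inl 1 else Sum.inl 0
  | Sum.inr (Sum.inl (_, Sum.inr _)), Sum.inr (Sum.inr _) => Sum.inl 0
  | Sum.inr (Sum.inr v), Sum.inr (Sum.inr v') => if v = v' then Sum.inl 1 else Sum.inl 0
  | Sum.inr (Sum.inr v), Sum.inr (Sum.inl (o, Sum.inl p)) =>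
      if IsFirst A o ∧ o.var = v ∧ p = 3 then Sum.inl 1 else Sum.inl 0
  | Sum.inr (Sum.inr _), Sum.inr (Sum.inl (_, Sum.inr _)) => Sum.inl 0
  | Sum.inr (Sum.inr _), Sum.inl _ => Sum.inl 0

/-- The permanent of a matrix over `k ∪ X` on an arbitrary index type, in `k[X]`. [cite: BurgisserClausenShokrollahi1997, (21.12)] -/
abbrev perY {ι : Type*} [Fintype ι] [DecidableEq ι] (M : Matrix ι ι (k ⊕ σ)) : MvPolynomial σ k :=
  (M.map entryVal).permanent

end Matrix

/-! ### The gadget re-indexed to `Fin`, monotonically on the original block -/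

section GB

variable {t N : ℕ}

/-- An explicit enumeration of the gadget indices, the original indices first and in order
(`castAdd r ↦ o r`). [cite: BurgisserClausenShokrollahi1997, Thm. (21.29)] -/
def gEquiv (N μ : ℕ) : Fin (N + (μ * 8 + 1)) ≃ GIdx N μ :=
  finSumFinEquiv.symm.trans (Equiv.sumCongr (Equiv.refl (Fin N))
    ((finSumFinEquiv (m := μ * 8) (n := 1)).symm.trans (Equiv.sumCongr
      ((finProdFinEquiv (m := μ) (n := 8)).symm.trans
        (Equiv.prodCongr (Equiv.refl (Fin μ)) (finSumFinEquiv (m := 4) (n := 4)).symm))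
      finOneEquiv)))

/-- The original indices are enumerated first and in order. [cite: BurgisserClausenShokrollahi1997, Thm. (21.29)] -/
@[simp] theorem gEquiv_castAdd (N μ : ℕ) (r : Fin N) :
    gEquiv N μ (Fin.castAdd (μ * 8 + 1) r) = GIdx.o r := by
  simp [gEquiv]

/-- Inverse form of `gEquiv_castAdd`. [cite: BurgisserClausenShokrollahi1997, Thm. (21.29)] -/
theorem gEquiv_symm_o (N μ : ℕ) (r : Fin N) :
    (gEquiv N μ).symm (GIdx.o r) = Fin.castAdd (μ * 8 + 1) r := by
  rw [Equiv.symm_apply_eq, gEquiv_castAdd]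

variable [CommRing k] (A : Matrix (Fin N) (Fin N) (k ⊕ (σ ⊕ Fin (t + 1))))

/-- The one-variable gadget with `ε = 1`, re-indexed to `Fin (N + 8μ + 1)` by `gEquiv`. [cite: BurgisserClausenShokrollahi1997, Thm. (21.29)] -/
def gB : Matrix (Fin (N + (yMult A * 8 + 1))) (Fin (N + (yMult A * 8 + 1))) (k ⊕ (σ ⊕ Fin t)) :=
  (gadget A 1).submatrix (gEquiv N (yMult A)) (gEquiv N (yMult A))

/-- Entries of `gB` through `gEquiv.symm`. [cite: BurgisserClausenShokrollahi1997, Thm. (21.29)] -/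
@[simp] theorem gB_symm_symm (x y : GIdx N (yMult A)) :
    gB A ((gEquiv N (yMult A)).symm x) ((gEquiv N (yMult A)).symm y) = gadget A 1 x y := by
  simp [gB]

/-- `per (gB A) = per (gadget A 1)` in the polynomial ring. [cite: BurgisserClausenShokrollahi1997, Thm. (21.29)] -/
theorem entryPer_gB : entryPer (gB A) = (gadgetM A 1).permanent := by
  unfold entryPer gB
  rw [← Matrix.submatrix_map, Matrix.permanent_submatrix_equiv]

/-- The gadget has the column property. [cite: BurgisserClausenShokrollahi1997, Thm. (21.29)] -/
theorem hasColumnProperty_gB (hA : HasColumnProperty A) : HasColumnProperty (gB A) := by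
  intro j i i' hi hi'
  exact (gEquiv N (yMult A)).injective (gadget_col_unique A 1 hA _ _ _ hi hi')

/-- **Where the variables of the gadget are**: a `Y_j` entry of `gadget A ε` sits in the original
block, at a position where `A` has `Y_{j+1}`. [cite: BurgisserClausenShokrollahi1997, Thm. (21.29)] -/
theorem gadget_eq_Y (hA : HasColumnProperty A) (ε : k) {x y : GIdx N (yMult A)} {j : Fin t}
    (h : gadget A ε x y = Sum.inr (Sum.inr j)) :
    ∃ r s, x = GIdx.o r ∧ y = GIdx.o s ∧ A r s = Sum.inr (Sum.inr j.succ) := by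
  rcases x with r | ⟨⟨j', p' | p'⟩⟩ | ⟨⟨⟩⟩
  · rcases y with s | ⟨⟨j'', p'' | p''⟩⟩ | ⟨⟨⟩⟩
    · exact ⟨r, s, rfl, rfl, (substFirst_eq_Y_iff _ _ _).1 (by simpa using h)⟩
    · simp at h
    · simp only [gadget_o_R] at h
      by_cases hp : p'' = 3
      · exfalso
        rw [if_pos hp] at h
        have h1 : (A r (yCol A j'')).isRight = true := isRight_substFirst (by rw [h]; rfl)
        have h2 := eq_Y0_of_mem_yCols A hA (yCol_mem A j'') h1
        rw [h2] at h
        simp [substFirst] at h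
      · rw [if_neg hp] at h
        simp at h
    · simp at h
  · exfalso
    rcases y with s | ⟨⟨j'', p'' | p''⟩⟩ | ⟨⟨⟩⟩
    · simp at h
    · simp only [gadget_L_L] at h; split_ifs at h
    · simp only [gadget_L_R] at h; split_ifs at h
    · simp only [gadget_L_c] at h; split_ifs at h
  · exfalso
    rcases y with s | ⟨⟨j'', p'' | p''⟩⟩ | ⟨⟨⟩⟩
    · simp only [gadget_R_o] at h; split_ifs at h
    · simp only [gadget_R_L] at h; split_ifs at h
    · simp only [gadget_R_R] at h; split_ifs at h
    · simp at h
  · exfalso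
    have h1 := gadget_c_isLeft A ε y
    rw [h] at h1
    simp at h1

/-- Conversely, a `Y_{j+1}` of `A` is a `Y_j` of the gadget. [cite: BurgisserClausenShokrollahi1997, Thm. (21.29)] -/
theorem gadget_o_o_eq_Y (ε : k) {r s : Fin N} {j : Fin t} (h : A r s = Sum.inr (Sum.inr j.succ)) :
    gadget A ε (GIdx.o r) (GIdx.o s) = Sum.inr (Sum.inr j) := by
  rw [gadget_o_o, substFirst_eq_Y_iff, h]

end GB

/-! ### The occurrences of `Y₀` ↔ the gadget's blocks -/

section Zero

variable {t N : ℕ} (A : Matrix (Fin N) (Fin N) (k ⊕ (σ ⊕ Fin (t + 1))))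

/-- The column of an occurrence of `Y₀` is a `Y₀`-column. [cite: BurgisserClausenShokrollahi1997, Thm. (21.29)] -/
theorem Occ.snd_mem_yCols (o : Occ A) (h : o.var = 0) : o.1.2 ∈ yCols A :=
  (mem_yCols_iff A _).2 ⟨o.1.1, (Occ.var_eq_iff A o 0).1 h⟩

/-- The index of an occurrence of `Y₀` in the increasing enumeration `yCol` of the `Y₀`-columns. [cite: BurgisserClausenShokrollahi1997, Thm. (21.29)] -/
def zIdx (o : Occ A) (h : o.var = 0) : Fin (yMult A) := yIdx A o.1.2 (Occ.snd_mem_yCols A o h)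

/-- `yCol (zIdx o) = col o`. [cite: BurgisserClausenShokrollahi1997, Thm. (21.29)] -/
@[simp] theorem yCol_zIdx (o : Occ A) (h : o.var = 0) : yCol A (zIdx A o h) = o.1.2 :=
  yCol_yIdx A _ _

/-- The row of the `Y₀` in the `j`-th `Y₀`-column (unique under the column property; chosen). [cite: BurgisserClausenShokrollahi1997, Thm. (21.29)] -/
def zRow (j : Fin (yMult A)) : Fin N :=
  Classical.choose ((mem_yCols_iff A _).1 (yCol_mem A j))

/-- `A (zRow j) (yCol j) = Y₀`. [cite: BurgisserClausenShokrollahi1997, Thm. (21.29)] -/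
theorem zRow_spec (j : Fin (yMult A)) : A (zRow A j) (yCol A j) = Sum.inr (Sum.inr 0) :=
  Classical.choose_spec ((mem_yCols_iff A _).1 (yCol_mem A j))

/-- The `j`-th occurrence of `Y₀` (in column order). [cite: BurgisserClausenShokrollahi1997, Thm. (21.29)] -/
def zOcc (j : Fin (yMult A)) : Occ A := Occ.mk' A (zRow A j) (yCol A j) 0 (zRow_spec A j)

/-- The variable of `zOcc j` is `Y₀`. [cite: BurgisserClausenShokrollahi1997, Thm. (21.29)] -/
@[simp] theorem zOcc_var (j : Fin (yMult A)) : (zOcc A j).var = 0 := Occ.var_mk' A _ _ _ _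

/-- The column of `zOcc j` is `yCol j`. [cite: BurgisserClausenShokrollahi1997, Thm. (21.29)] -/
@[simp] theorem zOcc_snd (j : Fin (yMult A)) : (zOcc A j).1.2 = yCol A j := rfl

/-- `zIdx ∘ zOcc = id`. [cite: BurgisserClausenShokrollahi1997, Thm. (21.29)] -/
@[simp] theorem zIdx_zOcc (j : Fin (yMult A)) (h : (zOcc A j).var = 0) : zIdx A (zOcc A j) h = j :=
  yIdx_yCol A j _

/-- `zOcc ∘ zIdx = id` (column property). [cite: BurgisserClausenShokrollahi1997, Thm. (21.29)] -/
theorem zOcc_zIdx (hA : HasColumnProperty A) (o : Occ A) (h : o.var = 0) : zOcc A (zIdx A o h) = o :=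
  Occ.eq_of_col_eq A hA (by rw [zOcc_snd, yCol_zIdx])

/-- `zIdx` is strictly monotone in the column. [cite: BurgisserClausenShokrollahi1997, Thm. (21.29)] -/
theorem zIdx_lt_iff (o o' : Occ A) (h : o.var = 0) (h' : o'.var = 0) :
    zIdx A o h < zIdx A o' h' ↔ o.1.2 < o'.1.2 := by
  rw [← (yCol A).lt_iff_lt, yCol_zIdx, yCol_zIdx]

/-- `zIdx` is monotone in the column. [cite: BurgisserClausenShokrollahi1997, Thm. (21.29)] -/
theorem zIdx_le_iff (o o' : Occ A) (h : o.var = 0) (h' : o'.var = 0) :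
    zIdx A o h ≤ zIdx A o' h' ↔ o.1.2 ≤ o'.1.2 := by
  rw [← (yCol A).le_iff_le, yCol_zIdx, yCol_zIdx]

/-- `IsNext` among the occurrences of `Y₀` is "`j' = j + 1`". [cite: BurgisserClausenShokrollahi1997, Thm. (21.29)] -/
theorem isNext_zero_iff (o o' : Occ A) (h : o.var = 0) (h' : o'.var = 0) :
    IsNext A o o' ↔ (zIdx A o' h').val = (zIdx A o h).val + 1 := by
  unfold IsNext
  rw [h, h']
  simp only [true_and]
  constructor
  · rintro ⟨hlt, hmin⟩
    have h1 : (zIdx A o h).val < (zIdx A o' h').val := Fin.lt_def.1 ((zIdx_lt_iff A o o' h h').2 hlt)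
    have hμ : (zIdx A o h).val + 1 < yMult A := lt_of_le_of_lt h1 (zIdx A o' h').isLt
    have h2 := hmin (zOcc A ⟨_, hμ⟩) (zOcc_var A _)
      ((zIdx_lt_iff A o _ h (zOcc_var A _)).1 (by rw [zIdx_zOcc, Fin.lt_def]; simp))
    have h3 : (zIdx A o' h').val ≤ (zIdx A o h).val + 1 := by
      have := (zIdx_le_iff A o' _ h' (zOcc_var A ⟨_, hμ⟩)).2 h2
      rw [zIdx_zOcc, Fin.le_def] at this
      exact this
    omega
  · intro heq
    refine ⟨(zIdx_lt_iff A o o' h h').1 (Fin.lt_def.2 (by omega)), fun o'' h'' hlt => ?_⟩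
    have h1 := Fin.lt_def.1 ((zIdx_lt_iff A o o'' h h'').2 hlt)
    exact (zIdx_le_iff A o' o'' h' h'').1 (Fin.le_def.2 (by omega))

/-- `IsLast` among the occurrences of `Y₀` is "`j + 1 = μ`". [cite: BurgisserClausenShokrollahi1997, Thm. (21.29)] -/
theorem isLast_zero_iff (o : Occ A) (h : o.var = 0) :
    IsLast A o ↔ (zIdx A o h).val + 1 = yMult A := by
  unfold IsLast
  rw [h]
  have hμ : 0 < yMult A := Fin.pos (zIdx A o h)
  constructor
  · intro H
    have h1 := H (zOcc A ⟨yMult A - 1, by omega⟩) (zOcc_var A _)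
    have h2 := (zIdx_le_iff A _ o (zOcc_var A _) h).2 h1
    rw [zIdx_zOcc, Fin.le_def] at h2
    have h3 := (zIdx A o h).isLt
    simp only at h2
    omega
  · intro H o' h'
    have h3 := (zIdx A o' h').isLt
    exact (zIdx_le_iff A o' o h' h).1 (Fin.le_def.2 (by omega))

/-- `IsFirst` among the occurrences of `Y₀` is "`j = 0`". [cite: BurgisserClausenShokrollahi1997, Thm. (21.29)] -/
theorem isFirst_zero_iff (o : Occ A) (h : o.var = 0) :
    IsFirst A o ↔ (zIdx A o h).val = 0 := by
  unfold IsFirst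
  rw [h]
  have hμ : 0 < yMult A := Fin.pos (zIdx A o h)
  constructor
  · intro H
    have h1 := H (zOcc A ⟨0, hμ⟩) (zOcc_var A _)
    have h2 := (zIdx_le_iff A o _ h (zOcc_var A _)).2 h1
    rw [zIdx_zOcc, Fin.le_def] at h2
    simp only at h2
    omega
  · intro H o' h'
    exact (zIdx_le_iff A o o' h h').1 (Fin.le_def.2 (by omega))

/-- The occurrences of `Y₀` are enumerated by `Fin μ`. [cite: BurgisserClausenShokrollahi1997, Thm. (21.29)] -/
theorem card_occ_zero (hA : HasColumnProperty A) :
    Fintype.card {o : Occ A // o.var = 0} = yMult A := by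
  rw [← Fintype.card_fin (yMult A)]
  refine (Fintype.card_congr (Equiv.ofBijective (fun j : Fin (yMult A) =>
    (⟨zOcc A j, zOcc_var A j⟩ : {o : Occ A // o.var = 0})) ⟨?_, ?_⟩)).symm
  · intro j j' hjj'
    have := congrArg (fun p : {o : Occ A // o.var = 0} => zIdx A p.1 p.2) hjj'
    simpa using this
  · rintro ⟨o, h⟩
    exact ⟨zIdx A o h, Subtype.ext (zOcc_zIdx A hA o h)⟩

/-- `Y₀` occurs: `μ ≥ 1`. [cite: BurgisserClausenShokrollahi1997, Thm. (21.29)] -/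
theorem yMult_pos_of_occ (hocc : ∀ j : Fin (t + 1), ∃ o : Occ A, o.var = j) : 0 < yMult A := by
  obtain ⟨o, ho⟩ := hocc 0
  exact Fin.pos (zIdx A o ho)

end Zero

/-! ### The other occurrences ↔ the occurrences of the gadget -/

section Succ

variable [CommRing k] {t N : ℕ} (A : Matrix (Fin N) (Fin N) (k ⊕ (σ ⊕ Fin (t + 1))))

/-- An occurrence of `Y_{j+1}` in `A`, read as the occurrence of `Y_j` in the gadget. [cite: BurgisserClausenShokrollahi1997, Thm. (21.29)] -/
def sOcc (o : Occ A) (h : o.var ≠ 0) : Occ (gB A) :=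
  Occ.mk' (gB A) ((gEquiv N (yMult A)).symm (GIdx.o o.1.1)) ((gEquiv N (yMult A)).symm (GIdx.o o.1.2))
    (o.var.pred h) (by rw [gB_symm_symm, gadget_o_o_eq_Y A 1 (j := o.var.pred h)]; rw [Fin.succ_pred]; exact o.entry)

/-- The variable index drops by one. [cite: BurgisserClausenShokrollahi1997, Thm. (21.29)] -/
@[simp] theorem sOcc_var (o : Occ A) (h : o.var ≠ 0) : (sOcc A o h).var = o.var.pred h :=
  Occ.var_mk' _ _ _ _ _

/-- The row of `sOcc o`. [cite: BurgisserClausenShokrollahi1997, Thm. (21.29)] -/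
@[simp] theorem sOcc_fst (o : Occ A) (h : o.var ≠ 0) :
    (sOcc A o h).1.1 = (gEquiv N (yMult A)).symm (GIdx.o o.1.1) := rfl

/-- The column of `sOcc o`. [cite: BurgisserClausenShokrollahi1997, Thm. (21.29)] -/
@[simp] theorem sOcc_snd (o : Occ A) (h : o.var ≠ 0) :
    (sOcc A o h).1.2 = (gEquiv N (yMult A)).symm (GIdx.o o.1.2) := rfl

/-- `sOcc` is injective. [cite: BurgisserClausenShokrollahi1997, Thm. (21.29)] -/
theorem sOcc_inj {o o' : Occ A} {h : o.var ≠ 0} {h' : o'.var ≠ 0} (heq : sOcc A o h = sOcc A o' h') : o = o' := by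
  have h1 := congrArg (fun õ : Occ (gB A) => õ.1.1) heq
  have h2 := congrArg (fun õ : Occ (gB A) => õ.1.2) heq
  simp only [sOcc_fst, sOcc_snd, Equiv.apply_eq_iff_eq, Sum.inl.injEq] at h1 h2
  exact Subtype.ext (Prod.ext h1 h2)

/-- Every occurrence of the gadget comes from an occurrence of some `Y_{j+1}` in `A`. [cite: BurgisserClausenShokrollahi1997, Thm. (21.29)] -/
theorem exists_sOcc (hA : HasColumnProperty A) (õ : Occ (gB A)) : ∃ (o : Occ A) (h : o.var ≠ 0), sOcc A o h = õ := by
  set e := gEquiv N (yMult A) with he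
  have hx : gadget A 1 (e õ.1.1) (e õ.1.2) = Sum.inr (Sum.inr õ.var) := by
    rw [← gB_symm_symm, Equiv.symm_apply_apply, Equiv.symm_apply_apply]; exact õ.entry
  obtain ⟨r, s, hr, hs, hrs⟩ := gadget_eq_Y A hA 1 hx
  refine ⟨Occ.mk' A r s _ hrs, by simp, Subtype.ext (Prod.ext ?_ ?_)⟩
  · show e.symm (GIdx.o r) = õ.1.1
    rw [← hr, Equiv.symm_apply_apply]
  · show e.symm (GIdx.o s) = õ.1.2
    rw [← hs, Equiv.symm_apply_apply]

/-- Same variable is preserved. [cite: BurgisserClausenShokrollahi1997, Thm. (21.29)] -/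
theorem sOcc_var_eq_iff (o o' : Occ A) (h : o.var ≠ 0) (h' : o'.var ≠ 0) :
    (sOcc A o h).var = (sOcc A o' h').var ↔ o.var = o'.var := by
  rw [sOcc_var, sOcc_var, Fin.pred_inj]

/-- Column order is preserved (strict). [cite: BurgisserClausenShokrollahi1997, Thm. (21.29)] -/
theorem sOcc_snd_lt_iff (o o' : Occ A) (h : o.var ≠ 0) (h' : o'.var ≠ 0) :
    (sOcc A o h).1.2 < (sOcc A o' h').1.2 ↔ o.1.2 < o'.1.2 := by
  rw [sOcc_snd, sOcc_snd, gEquiv_symm_o, gEquiv_symm_o, Fin.lt_def, Fin.lt_def]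
  simp

/-- Column order is preserved. [cite: BurgisserClausenShokrollahi1997, Thm. (21.29)] -/
theorem sOcc_snd_le_iff (o o' : Occ A) (h : o.var ≠ 0) (h' : o'.var ≠ 0) :
    (sOcc A o h).1.2 ≤ (sOcc A o' h').1.2 ↔ o.1.2 ≤ o'.1.2 := by
  rw [sOcc_snd, sOcc_snd, gEquiv_symm_o, gEquiv_symm_o, Fin.le_def, Fin.le_def]
  simp

/-- `IsFirst` is preserved. [cite: BurgisserClausenShokrollahi1997, Thm. (21.29)] -/
theorem isFirst_sOcc_iff (hA : HasColumnProperty A) (o : Occ A) (h : o.var ≠ 0) :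
    IsFirst (gB A) (sOcc A o h) ↔ IsFirst A o := by
  unfold IsFirst
  constructor
  · intro H o' hv
    have h' : o'.var ≠ 0 := by rw [hv]; exact h
    exact (sOcc_snd_le_iff A o o' h h').1 (H (sOcc A o' h') ((sOcc_var_eq_iff A o' o h' h).2 hv))
  · intro H õ hv
    obtain ⟨o', h', rfl⟩ := exists_sOcc A hA õ
    exact (sOcc_snd_le_iff A o o' h h').2 (H o' ((sOcc_var_eq_iff A o' o h' h).1 hv))

/-- `IsLast` is preserved. [cite: BurgisserClausenShokrollahi1997, Thm. (21.29)] -/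
theorem isLast_sOcc_iff (hA : HasColumnProperty A) (o : Occ A) (h : o.var ≠ 0) :
    IsLast (gB A) (sOcc A o h) ↔ IsLast A o := by
  unfold IsLast
  constructor
  · intro H o' hv
    have h' : o'.var ≠ 0 := by rw [hv]; exact h
    exact (sOcc_snd_le_iff A o' o h' h).1 (H (sOcc A o' h') ((sOcc_var_eq_iff A o' o h' h).2 hv))
  · intro H õ hv
    obtain ⟨o', h', rfl⟩ := exists_sOcc A hA õ
    exact (sOcc_snd_le_iff A o' o h' h).2 (H o' ((sOcc_var_eq_iff A o' o h' h).1 hv))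

/-- `IsNext` is preserved. [cite: BurgisserClausenShokrollahi1997, Thm. (21.29)] -/
theorem isNext_sOcc_iff (hA : HasColumnProperty A) (o o' : Occ A) (h : o.var ≠ 0) (h' : o'.var ≠ 0) :
    IsNext (gB A) (sOcc A o h) (sOcc A o' h') ↔ IsNext A o o' := by
  unfold IsNext
  rw [sOcc_var_eq_iff, sOcc_snd_lt_iff]
  refine and_congr_right fun _ => and_congr_right fun _ => ⟨fun H o'' hv hlt => ?_, fun H õ hv hlt => ?_⟩
  · have h'' : o''.var ≠ 0 := by rw [hv]; exact h
    exact (sOcc_snd_le_iff A o' o'' h' h'').1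
      (H (sOcc A o'' h'') ((sOcc_var_eq_iff A o'' o h'' h).2 hv) ((sOcc_snd_lt_iff A o o'' h h'').2 hlt))
  · obtain ⟨o'', h'', rfl⟩ := exists_sOcc A hA õ
    exact (sOcc_snd_le_iff A o' o'' h' h'').2
      (H o'' ((sOcc_var_eq_iff A o'' o h'' h).1 hv) ((sOcc_snd_lt_iff A o o'' h h'').1 hlt))

/-- The other occurrences are in bijection with the occurrences of the gadget. [cite: BurgisserClausenShokrollahi1997, Thm. (21.29)] -/
theorem card_occ_succ (hA : HasColumnProperty A) :
    Fintype.card {o : Occ A // ¬ o.var = 0} = Fintype.card (Occ (gB A)) := by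
  refine Fintype.card_congr (Equiv.ofBijective
    (fun p : {o : Occ A // ¬ o.var = 0} => sOcc A p.1 p.2) ⟨?_, ?_⟩)
  · intro p p' hpp'
    exact Subtype.ext (sOcc_inj A hpp')
  · intro õ
    obtain ⟨o, h, rfl⟩ := exists_sOcc A hA õ
    exact ⟨⟨o, h⟩, rfl⟩

/-- **Counting occurrences**: `#Occ A = μ + #Occ (gB A)`. [cite: BurgisserClausenShokrollahi1997, Thm. (21.29)] -/
theorem card_occ (hA : HasColumnProperty A) :
    Fintype.card (Occ A) = yMult A + Fintype.card (Occ (gB A)) := by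
  rw [← Fintype.card_congr (Equiv.sumCompl fun o : Occ A => o.var = 0), Fintype.card_sum,
    card_occ_zero A hA, card_occ_succ A hA]

/-- Every variable `Y_1, …, Y_t` of `A` still occurs in the gadget. [cite: BurgisserClausenShokrollahi1997, Thm. (21.29)] -/
theorem occ_gB_of_occ (hocc : ∀ j : Fin (t + 1), ∃ o : Occ A, o.var = j) (j : Fin t) :
    ∃ õ : Occ (gB A), õ.var = j := by
  obtain ⟨o, ho⟩ := hocc j.succ
  have h : o.var ≠ 0 := by rw [ho]; exact Fin.succ_ne_zero j
  exact ⟨sOcc A o h, by rw [sOcc_var]; simp [ho]⟩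

end Succ

/-! ### Entry formulas of the all-at-once matrix -/

section Entries

variable [CommRing k] {t N : ℕ} (A : Matrix (Fin N) (Fin N) (k ⊕ (σ ⊕ Fin t)))

/-- An original index. [cite: BurgisserClausenShokrollahi1997, Thm. (21.29)] -/
abbrev ao (r : Fin N) : AIdx A := Sum.inl r
/-- The index `L_{o,p}`. [cite: BurgisserClausenShokrollahi1997, Thm. (21.29)] -/
abbrev aL (o : Occ A) (p : Fin 4) : AIdx A := Sum.inr (Sum.inl (o, Sum.inl p))
/-- The index `R_{o,p}`. [cite: BurgisserClausenShokrollahi1997, Thm. (21.29)] -/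
abbrev aR (o : Occ A) (p : Fin 4) : AIdx A := Sum.inr (Sum.inl (o, Sum.inr p))
/-- The control index `c_v`. [cite: BurgisserClausenShokrollahi1997, Thm. (21.29)] -/
abbrev ac (v : Fin t) : AIdx A := Sum.inr (Sum.inr v)

/-- Entry formula. [cite: BurgisserClausenShokrollahi1997, Thm. (21.29)] -/
@[simp] theorem allAtOnce_o_o (r s : Fin N) :
    allAtOnce A (ao A r) (ao A s) = boolSubstEntry (fun _ => false) (A r s) := rfl
/-- Entry formula. [cite: BurgisserClausenShokrollahi1997, Thm. (21.29)] -/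
@[simp] theorem allAtOnce_o_R (r : Fin N) (o : Occ A) (p : Fin 4) :
    allAtOnce A (ao A r) (aR A o p) =
      if p = 3 then boolSubstEntry (fun j => decide (j = o.var)) (A r o.1.2) else Sum.inl 0 := rfl
/-- Entry formula. [cite: BurgisserClausenShokrollahi1997, Thm. (21.29)] -/
@[simp] theorem allAtOnce_o_L (r : Fin N) (o : Occ A) (p : Fin 4) :
    allAtOnce A (ao A r) (aL A o p) = Sum.inl 0 := rfl
/-- Entry formula. [cite: BurgisserClausenShokrollahi1997, Thm. (21.29)] -/
@[simp] theorem allAtOnce_o_c (r : Fin N) (v : Fin t) : allAtOnce A (ao A r) (ac A v) = Sum.inl 0 := rfl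
/-- Entry formula. [cite: BurgisserClausenShokrollahi1997, Thm. (21.29)] -/
@[simp] theorem allAtOnce_L_L (o o' : Occ A) (p p' : Fin 4) :
    allAtOnce A (aL A o p) (aL A o' p') = if o = o' then Sum.inl (valiantV p p')
      else if p = 0 ∧ p' = 3 ∧ IsNext A o o' then Sum.inl 1 else Sum.inl 0 := rfl
/-- Entry formula. [cite: BurgisserClausenShokrollahi1997, Thm. (21.29)] -/
@[simp] theorem allAtOnce_L_c (o : Occ A) (p : Fin 4) (v : Fin t) :
    allAtOnce A (aL A o p) (ac A v) = if p = 0 ∧ IsLast A o ∧ o.var = v then Sum.inl 1 else Sum.inl 0 := rfl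
/-- Entry formula. [cite: BurgisserClausenShokrollahi1997, Thm. (21.29)] -/
@[simp] theorem allAtOnce_L_R (o o' : Occ A) (p p' : Fin 4) :
    allAtOnce A (aL A o p) (aR A o' p') = if o = o' ∧ p = 3 ∧ p' = 0 then Sum.inl 1 else Sum.inl 0 := rfl
/-- Entry formula. [cite: BurgisserClausenShokrollahi1997, Thm. (21.29)] -/
@[simp] theorem allAtOnce_L_o (o : Occ A) (p : Fin 4) (s : Fin N) : allAtOnce A (aL A o p) (ao A s) = Sum.inl 0 := rfl
/-- Entry formula. [cite: BurgisserClausenShokrollahi1997, Thm. (21.29)] -/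
@[simp] theorem allAtOnce_R_R (o o' : Occ A) (p p' : Fin 4) :
    allAtOnce A (aR A o p) (aR A o' p') = if o = o' then Sum.inl (valiantV p p') else Sum.inl 0 := rfl
/-- Entry formula. [cite: BurgisserClausenShokrollahi1997, Thm. (21.29)] -/
@[simp] theorem allAtOnce_R_o (o : Occ A) (p : Fin 4) (s : Fin N) :
    allAtOnce A (aR A o p) (ao A s) = if p = 0 ∧ s = o.1.2 then Sum.inl 1 else Sum.inl 0 := rfl
/-- Entry formula. [cite: BurgisserClausenShokrollahi1997, Thm. (21.29)] -/
@[simp] theorem allAtOnce_R_L (o o' : Occ A) (p p' : Fin 4) :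
    allAtOnce A (aR A o p) (aL A o' p') = if o = o' ∧ p = 3 ∧ p' = 0 then Sum.inl 1 else Sum.inl 0 := rfl
/-- Entry formula. [cite: BurgisserClausenShokrollahi1997, Thm. (21.29)] -/
@[simp] theorem allAtOnce_R_c (o : Occ A) (p : Fin 4) (v : Fin t) : allAtOnce A (aR A o p) (ac A v) = Sum.inl 0 := rfl
/-- Entry formula. [cite: BurgisserClausenShokrollahi1997, Thm. (21.29)] -/
@[simp] theorem allAtOnce_c_c (v v' : Fin t) :
    allAtOnce A (ac A v) (ac A v') = if v = v' then Sum.inl 1 else Sum.inl 0 := rfl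
/-- Entry formula. [cite: BurgisserClausenShokrollahi1997, Thm. (21.29)] -/
@[simp] theorem allAtOnce_c_L (v : Fin t) (o : Occ A) (p : Fin 4) :
    allAtOnce A (ac A v) (aL A o p) = if IsFirst A o ∧ o.var = v ∧ p = 3 then Sum.inl 1 else Sum.inl 0 := rfl
/-- Entry formula. [cite: BurgisserClausenShokrollahi1997, Thm. (21.29)] -/
@[simp] theorem allAtOnce_c_R (v : Fin t) (o : Occ A) (p : Fin 4) : allAtOnce A (ac A v) (aR A o p) = Sum.inl 0 := rfl
/-- Entry formula. [cite: BurgisserClausenShokrollahi1997, Thm. (21.29)] -/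
@[simp] theorem allAtOnce_c_o (v : Fin t) (s : Fin N) : allAtOnce A (ac A v) (ao A s) = Sum.inl 0 := rfl

omit [CommRing k] in
/-- `IsNext` forces the same variable. [cite: BurgisserClausenShokrollahi1997, Thm. (21.29)] -/
theorem IsNext.var_eq {o o' : Occ A} (h : IsNext A o o') : o'.var = o.var := h.1

end Entries

/-! ### Substitution bookkeeping -/

section Subst

variable [CommRing k] {t : ℕ}

/-- `Y := 0` after `Y₀ := 0` is `Y := 0`. [cite: BurgisserClausenShokrollahi1997, Thm. (21.29)] -/
theorem bse_false_substFirst_zero (x : k ⊕ (σ ⊕ Fin (t + 1))) :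
    boolSubstEntry (fun _ : Fin t => false) (substFirst (0 : k) x) =
      boolSubstEntry (fun _ : Fin (t + 1) => false) x := by
  rcases x with c | i | j
  · rfl
  · rfl
  · cases j using Fin.cases with
    | zero => simp [substFirst, boolSubstEntry]
    | succ j => simp [substFirst, boolSubstEntry]

/-- `Y := 0` after `Y₀ := 1` is `Y₀ := 1`, other `Y := 0`. [cite: BurgisserClausenShokrollahi1997, Thm. (21.29)] -/
theorem bse_false_substFirst_one (x : k ⊕ (σ ⊕ Fin (t + 1))) :
    boolSubstEntry (fun _ : Fin t => false) (substFirst (1 : k) x) =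
      boolSubstEntry (fun j : Fin (t + 1) => decide (j = 0)) x := by
  rcases x with c | i | j
  · rfl
  · rfl
  · cases j using Fin.cases with
    | zero => simp [substFirst, boolSubstEntry]
    | succ j => simp [substFirst, boolSubstEntry, Fin.succ_ne_zero]

/-- `Y_{j₀} := 1` (others `0`) after `Y₀ := 0` is `Y_{j₀+1} := 1` (others `0`). [cite: BurgisserClausenShokrollahi1997, Thm. (21.29)] -/
theorem bse_eq_substFirst_zero (x : k ⊕ (σ ⊕ Fin (t + 1))) (j₀ : Fin t) :
    boolSubstEntry (fun j : Fin t => decide (j = j₀)) (substFirst (0 : k) x) =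
      boolSubstEntry (fun j : Fin (t + 1) => decide (j = j₀.succ)) x := by
  rcases x with c | i | j
  · rfl
  · rfl
  · cases j using Fin.cases with
    | zero => simp [substFirst, boolSubstEntry, (Fin.succ_ne_zero j₀).symm]
    | succ j => simp [substFirst, boolSubstEntry, Fin.succ_inj]

/-- Constants are untouched by Boolean substitution. [cite: BurgisserClausenShokrollahi1997, Thm. (21.29)] -/
@[simp] theorem bse_inl {τ : Type*} {t' : ℕ} (f : Fin t' → Bool) (c : k) :
    boolSubstEntry (σ := τ) f (Sum.inl c) = Sum.inl c := rfl

/-- Boolean substitution commutes with `if`. [folklore] -/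
theorem bse_ite {τ : Type*} {t' : ℕ} (f : Fin t' → Bool) (P : Prop) [Decidable P] (x y : k ⊕ (τ ⊕ Fin t')) :
    boolSubstEntry f (if P then x else y) = if P then boolSubstEntry f x else boolSubstEntry f y := by
  split_ifs <;> rfl

end Subst

/-! ### The bisimulation re-indexing `Φ : AIdx A → AIdx (gB A)` -/

section Phi

variable [CommRing k] {t N : ℕ} (A : Matrix (Fin N) (Fin N) (k ⊕ (σ ⊕ Fin (t + 1))))

/-- The re-indexing of the bisimulation: original indices to original indices of the gadget;
blocks of an occurrence of `Y₀` to the gadget's blocks `L_{j,·}, R_{j,·}` (`j` its index in column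
order); blocks of the other occurrences to the blocks of the corresponding occurrence of the
gadget; the control of `Y₀` to the gadget's control `c`, the control of `Y_{j+1}` to the control
of `Y_j`. [cite: BurgisserClausenShokrollahi1997, Thm. (21.29)] -/
def Φ : AIdx A → AIdx (gB A)
  | Sum.inl r => Sum.inl ((gEquiv N (yMult A)).symm (GIdx.o r))
  | Sum.inr (Sum.inl (o, q)) =>
      if h : o.var = 0 then Sum.inl ((gEquiv N (yMult A)).symm (Sum.inr (Sum.inl (zIdx A o h, q))))
      else Sum.inr (Sum.inl (sOcc A o h, q))
  | Sum.inr (Sum.inr j) =>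
      Fin.cases (Sum.inl ((gEquiv N (yMult A)).symm GIdx.c)) (fun j' => Sum.inr (Sum.inr j')) j

/-- `Φ` on an original index. [cite: BurgisserClausenShokrollahi1997, Thm. (21.29)] -/
@[simp] theorem Φ_o (r : Fin N) : Φ A (ao A r) = Sum.inl ((gEquiv N (yMult A)).symm (GIdx.o r)) := rfl

/-- `Φ` on `L_{o,p}`, `o` an occurrence of `Y₀`. [cite: BurgisserClausenShokrollahi1997, Thm. (21.29)] -/
theorem Φ_L_zero (o : Occ A) (h : o.var = 0) (p : Fin 4) :
    Φ A (aL A o p) = Sum.inl ((gEquiv N (yMult A)).symm (GIdx.L (zIdx A o h) p)) := by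
  simp [Φ, h]

/-- `Φ` on `R_{o,p}`, `o` an occurrence of `Y₀`. [cite: BurgisserClausenShokrollahi1997, Thm. (21.29)] -/
theorem Φ_R_zero (o : Occ A) (h : o.var = 0) (p : Fin 4) :
    Φ A (aR A o p) = Sum.inl ((gEquiv N (yMult A)).symm (GIdx.R (zIdx A o h) p)) := by
  simp [Φ, h]

/-- `Φ` on `L_{o,p}`, `o` an occurrence of some `Y_{j+1}`. [cite: BurgisserClausenShokrollahi1997, Thm. (21.29)] -/
theorem Φ_L_succ (o : Occ A) (h : o.var ≠ 0) (p : Fin 4) :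
    Φ A (aL A o p) = aL (gB A) (sOcc A o h) p := by
  simp [Φ, h]

/-- `Φ` on `R_{o,p}`, `o` an occurrence of some `Y_{j+1}`. [cite: BurgisserClausenShokrollahi1997, Thm. (21.29)] -/
theorem Φ_R_succ (o : Occ A) (h : o.var ≠ 0) (p : Fin 4) :
    Φ A (aR A o p) = aR (gB A) (sOcc A o h) p := by
  simp [Φ, h]

/-- `Φ` on the control of `Y₀`. [cite: BurgisserClausenShokrollahi1997, Thm. (21.29)] -/
@[simp] theorem Φ_c_zero : Φ A (ac A 0) = Sum.inl ((gEquiv N (yMult A)).symm GIdx.c) := rfl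

/-- `Φ` on the control of `Y_{j+1}`. [cite: BurgisserClausenShokrollahi1997, Thm. (21.29)] -/
@[simp] theorem Φ_c_succ (j : Fin t) : Φ A (ac A j.succ) = ac (gB A) j := by
  simp [Φ]

/-- `Φ` is injective (column property). [cite: BurgisserClausenShokrollahi1997, Thm. (21.29)] -/
theorem Φ_injective (hA : HasColumnProperty A) : Function.Injective (Φ A) := by
  intro x y hxy
  rcases x with r | ⟨o, q⟩ | j <;> rcases y with r' | ⟨o', q'⟩ | j'
  · simp only [Φ, Sum.inl.injEq, Equiv.apply_eq_iff_eq] at hxy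
    rw [hxy]
  · by_cases h' : o'.var = 0 <;> simp [Φ, h'] at hxy
  · cases j' using Fin.cases <;> simp [Φ] at hxy
  · by_cases h : o.var = 0 <;> simp [Φ, h] at hxy
  · by_cases h : o.var = 0 <;> by_cases h' : o'.var = 0
    · simp only [Φ, h, h', dif_pos, Sum.inl.injEq, Equiv.apply_eq_iff_eq, Sum.inr.injEq, Prod.mk.injEq] at hxy
      obtain ⟨h1, h2⟩ := hxy
      have := congrArg (zOcc A) h1
      rw [zOcc_zIdx A hA, zOcc_zIdx A hA] at this
      subst this; subst h2; rfl
    · simp [Φ, h, h'] at hxy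
    · simp [Φ, h, h'] at hxy
    · simp only [Φ, h, h', dif_neg, not_false_eq_true, Sum.inr.injEq, Sum.inl.injEq, Prod.mk.injEq] at hxy
      obtain ⟨h1, h2⟩ := hxy
      have := sOcc_inj A h1
      subst this; subst h2; rfl
  · by_cases h : o.var = 0 <;> cases j' using Fin.cases <;> simp [Φ, h] at hxy
  · cases j using Fin.cases <;> simp [Φ] at hxy
  · by_cases h' : o'.var = 0 <;> cases j using Fin.cases <;> simp [Φ, h'] at hxy
  · cases j using Fin.cases <;> cases j' using Fin.cases
    · rfl
    · simp [Φ] at hxy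
    · simp [Φ] at hxy
    · simp only [Φ, Fin.cases_succ, Sum.inr.injEq] at hxy
      rw [hxy]

/-- The two index types have the same size. [cite: BurgisserClausenShokrollahi1997, Thm. (21.29)] -/
theorem card_AIdx (hA : HasColumnProperty A) : Fintype.card (AIdx A) = Fintype.card (AIdx (gB A)) := by
  simp only [Fintype.card_sum, Fintype.card_prod, Fintype.card_fin, card_occ A hA]
  ring

/-- `Φ` as an equivalence. [cite: BurgisserClausenShokrollahi1997, Thm. (21.29)] -/
def ΦEquiv (hA : HasColumnProperty A) : AIdx A ≃ AIdx (gB A) :=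
  Equiv.ofBijective (Φ A)
    ((Fintype.bijective_iff_injective_and_card _).2 ⟨Φ_injective A hA, card_AIdx A hA⟩)

/-- `ΦEquiv` is `Φ`. [cite: BurgisserClausenShokrollahi1997, Thm. (21.29)] -/
@[simp] theorem ΦEquiv_apply (hA : HasColumnProperty A) (x : AIdx A) : ΦEquiv A hA x = Φ A x := rfl

end Phi

/-! ### The bisimulation: entries agree -/

section Bisim

variable [CommRing k] {t N : ℕ} (A : Matrix (Fin N) (Fin N) (k ⊕ (σ ⊕ Fin (t + 1))))

omit [CommRing k] in
/-- `zIdx` is injective (column property). [cite: BurgisserClausenShokrollahi1997, Thm. (21.29)] -/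
theorem zIdx_eq_iff (hA : HasColumnProperty A) {o o' : Occ A} (h : o.var = 0) (h' : o'.var = 0) :
    zIdx A o h = zIdx A o' h' ↔ o = o' := by
  constructor
  · intro heq
    have := congrArg (zOcc A) heq
    rwa [zOcc_zIdx A hA, zOcc_zIdx A hA] at this
  · rintro rfl; rfl

/-- `sOcc` is injective, as an iff. [cite: BurgisserClausenShokrollahi1997, Thm. (21.29)] -/
theorem sOcc_eq_iff {o o' : Occ A} (h : o.var ≠ 0) (h' : o'.var ≠ 0) :
    sOcc A o h = sOcc A o' h' ↔ o = o' :=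
  ⟨fun heq => sOcc_inj A heq, by rintro rfl; rfl⟩

omit [CommRing k] in
/-- Occurrences of different variables are different. [folklore] -/
theorem occ_ne_of_var {o o' : Occ A} (h : o.var = 0) (h' : o'.var ≠ 0) : o ≠ o' :=
  fun heq => h' (heq ▸ h)

omit [CommRing k] in
/-- No `IsNext` between occurrences of different variables. [folklore] -/
theorem not_isNext_of_var {o o' : Occ A} (h : (o.var = 0) ≠ (o'.var = 0)) : ¬ IsNext A o o' :=
  fun hn => h (by rw [hn.var_eq])

/-- **The bisimulation**: through `Φ`, the all-at-once matrix of the gadget is the all-at-once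
matrix of `A`. [cite: BurgisserClausenShokrollahi1997, Thm. (21.29)] -/
theorem allAtOnce_Φ (hA : HasColumnProperty A) (x y : AIdx A) :
    allAtOnce (gB A) (Φ A x) (Φ A y) = allAtOnce A x y := by
  rcases x with r | ⟨o, p | p⟩ | j <;> rcases y with s | ⟨o', p' | p'⟩ | j'
  -- row: original index
  · simp only [Φ_o, allAtOnce_o_o, gB_symm_symm, gadget_o_o, bse_false_substFirst_zero]
  · by_cases h' : o'.var = 0
    · rw [Φ_o, Φ_L_zero A o' h']
      simp only [allAtOnce_o_o, gB_symm_symm, gadget_o_L, allAtOnce_o_L, bse_inl]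
    · rw [Φ_o, Φ_L_succ A o' h']
      simp only [allAtOnce_o_L]
  · by_cases h' : o'.var = 0
    · rw [Φ_o, Φ_R_zero A o' h']
      simp only [allAtOnce_o_o, gB_symm_symm, gadget_o_R, allAtOnce_o_R, bse_ite,
        bse_false_substFirst_one, bse_inl, yCol_zIdx, h']
    · rw [Φ_o, Φ_R_succ A o' h']
      simp only [allAtOnce_o_R, sOcc_snd, sOcc_var, gB_symm_symm, gadget_o_o, bse_eq_substFirst_zero,
        Fin.succ_pred]
  · cases j' using Fin.cases with
    | zero =>
      rw [Φ_o, Φ_c_zero]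
      simp only [allAtOnce_o_o, gB_symm_symm, gadget_o_c, allAtOnce_o_c, bse_inl]
    | succ j' =>
      rw [Φ_o, Φ_c_succ]
      simp only [allAtOnce_o_c]
  -- row: `L_{o,p}`
  · by_cases h : o.var = 0
    · rw [Φ_L_zero A o h, Φ_o]
      simp only [allAtOnce_o_o, gB_symm_symm, gadget_L_o, allAtOnce_L_o, bse_inl]
    · rw [Φ_L_succ A o h, Φ_o]
      simp only [allAtOnce_L_o]
  · by_cases h : o.var = 0 <;> by_cases h' : o'.var = 0
    · rw [Φ_L_zero A o h, Φ_L_zero A o' h']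
      simp only [allAtOnce_o_o, gB_symm_symm, gadget_L_L, allAtOnce_L_L, bse_ite, bse_inl,
        zIdx_eq_iff A hA, isNext_zero_iff A o o' h h']
    · rw [Φ_L_zero A o h, Φ_L_succ A o' h']
      have hne := occ_ne_of_var A h h'
      have hnn := not_isNext_of_var A (o := o) (o' := o') (by simp [h, h'])
      simp [allAtOnce_L_L, hne, hnn]
    · rw [Φ_L_succ A o h, Φ_L_zero A o' h']
      have hne := (occ_ne_of_var A h' h).symm
      have hnn := not_isNext_of_var A (o := o) (o' := o') (by simp [h, h'])
      simp [allAtOnce_L_L, hne, hnn]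
    · rw [Φ_L_succ A o h, Φ_L_succ A o' h']
      simp only [allAtOnce_L_L, sOcc_eq_iff, isNext_sOcc_iff A hA]
  · by_cases h : o.var = 0 <;> by_cases h' : o'.var = 0
    · rw [Φ_L_zero A o h, Φ_R_zero A o' h']
      simp only [allAtOnce_o_o, gB_symm_symm, gadget_L_R, allAtOnce_L_R, bse_ite, bse_inl,
        zIdx_eq_iff A hA]
    · rw [Φ_L_zero A o h, Φ_R_succ A o' h']
      have hne := occ_ne_of_var A h h'
      simp [allAtOnce_o_R, allAtOnce_L_R, sOcc_snd, gB_symm_symm, gadget_L_o, hne]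
    · rw [Φ_L_succ A o h, Φ_R_zero A o' h']
      have hne := (occ_ne_of_var A h' h).symm
      simp [allAtOnce_L_o, allAtOnce_L_R, hne]
    · rw [Φ_L_succ A o h, Φ_R_succ A o' h']
      simp only [allAtOnce_L_R, sOcc_eq_iff]
  · by_cases h : o.var = 0
    · cases j' using Fin.cases with
      | zero =>
        rw [Φ_L_zero A o h, Φ_c_zero]
        simp only [allAtOnce_o_o, gB_symm_symm, gadget_L_c, allAtOnce_L_c, bse_ite, bse_inl,
          isLast_zero_iff A o h, h, and_true]
      | succ j' =>
        rw [Φ_L_zero A o h, Φ_c_succ]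
        simp [allAtOnce_o_c, allAtOnce_L_c, h, (Fin.succ_ne_zero j').symm]
    · cases j' using Fin.cases with
      | zero =>
        rw [Φ_L_succ A o h, Φ_c_zero]
        simp [allAtOnce_L_o, allAtOnce_L_c, h]
      | succ j' =>
        rw [Φ_L_succ A o h, Φ_c_succ]
        simp only [allAtOnce_L_c, isLast_sOcc_iff A hA, sOcc_var, Fin.pred_eq_iff_eq_succ]
  -- row: `R_{o,p}`
  · by_cases h : o.var = 0
    · rw [Φ_R_zero A o h, Φ_o]
      simp only [allAtOnce_o_o, gB_symm_symm, gadget_R_o, allAtOnce_R_o, bse_ite, bse_inl, yCol_zIdx]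
    · rw [Φ_R_succ A o h, Φ_o]
      simp only [allAtOnce_R_o, sOcc_snd, Equiv.apply_eq_iff_eq, Sum.inl.injEq]
  · by_cases h : o.var = 0 <;> by_cases h' : o'.var = 0
    · rw [Φ_R_zero A o h, Φ_L_zero A o' h']
      simp only [allAtOnce_o_o, gB_symm_symm, gadget_R_L, allAtOnce_R_L, bse_ite, bse_inl,
        zIdx_eq_iff A hA]
    · rw [Φ_R_zero A o h, Φ_L_succ A o' h']
      have hne := occ_ne_of_var A h h'
      simp [allAtOnce_o_L, allAtOnce_R_L, hne]
    · rw [Φ_R_succ A o h, Φ_L_zero A o' h']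
      have hne := (occ_ne_of_var A h' h).symm
      simp [allAtOnce_R_o, allAtOnce_R_L, sOcc_snd, hne]
    · rw [Φ_R_succ A o h, Φ_L_succ A o' h']
      simp only [allAtOnce_R_L, sOcc_eq_iff]
  · by_cases h : o.var = 0 <;> by_cases h' : o'.var = 0
    · rw [Φ_R_zero A o h, Φ_R_zero A o' h']
      simp only [allAtOnce_o_o, gB_symm_symm, gadget_R_R, allAtOnce_R_R, bse_ite, bse_inl,
        zIdx_eq_iff A hA]
    · rw [Φ_R_zero A o h, Φ_R_succ A o' h']
      have hne := occ_ne_of_var A h h'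
      have hcol : o'.1.2 ≠ o.1.2 := fun hc => hne (Occ.eq_of_col_eq A hA hc).symm
      simp [allAtOnce_o_R, allAtOnce_R_R, sOcc_snd, gB_symm_symm, gadget_R_o, yCol_zIdx, hcol, hne]
    · rw [Φ_R_succ A o h, Φ_R_zero A o' h']
      have hne := (occ_ne_of_var A h' h).symm
      simp [allAtOnce_R_o, allAtOnce_R_R, sOcc_snd, hne]
    · rw [Φ_R_succ A o h, Φ_R_succ A o' h']
      simp only [allAtOnce_R_R, sOcc_eq_iff]
  · by_cases h : o.var = 0
    · cases j' using Fin.cases with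
      | zero =>
        rw [Φ_R_zero A o h, Φ_c_zero]
        simp only [allAtOnce_o_o, gB_symm_symm, gadget_R_c, allAtOnce_R_c, bse_inl]
      | succ j' =>
        rw [Φ_R_zero A o h, Φ_c_succ]
        simp only [allAtOnce_o_c, allAtOnce_R_c]
    · cases j' using Fin.cases with
      | zero =>
        rw [Φ_R_succ A o h, Φ_c_zero]
        simp [allAtOnce_R_o, allAtOnce_R_c, sOcc_snd]
      | succ j' =>
        rw [Φ_R_succ A o h, Φ_c_succ]
        simp only [allAtOnce_R_c]
  -- row: control
  · cases j using Fin.cases with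
    | zero =>
      rw [Φ_c_zero, Φ_o]
      simp only [allAtOnce_o_o, gB_symm_symm, gadget_c_o, allAtOnce_c_o, bse_inl]
    | succ j =>
      rw [Φ_c_succ, Φ_o]
      simp only [allAtOnce_c_o]
  · cases j using Fin.cases with
    | zero =>
      by_cases h' : o'.var = 0
      · rw [Φ_c_zero, Φ_L_zero A o' h']
        simp only [allAtOnce_o_o, gB_symm_symm, gadget_c_L, allAtOnce_c_L, bse_ite, bse_inl,
          isFirst_zero_iff A o' h', h', true_and]
      · rw [Φ_c_zero, Φ_L_succ A o' h']
        simp [allAtOnce_o_L, allAtOnce_c_L, h']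
    | succ j =>
      by_cases h' : o'.var = 0
      · rw [Φ_c_succ, Φ_L_zero A o' h']
        simp [allAtOnce_c_o, allAtOnce_c_L, h', (Fin.succ_ne_zero j).symm]
      · rw [Φ_c_succ, Φ_L_succ A o' h']
        simp only [allAtOnce_c_L, isFirst_sOcc_iff A hA, sOcc_var, Fin.pred_eq_iff_eq_succ]
  · cases j using Fin.cases with
    | zero =>
      by_cases h' : o'.var = 0
      · rw [Φ_c_zero, Φ_R_zero A o' h']
        simp only [allAtOnce_o_o, gB_symm_symm, gadget_c_R, allAtOnce_c_R, bse_inl]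
      · rw [Φ_c_zero, Φ_R_succ A o' h']
        simp [allAtOnce_o_R, allAtOnce_c_R, sOcc_snd, gB_symm_symm, gadget_c_o]
    | succ j =>
      by_cases h' : o'.var = 0
      · rw [Φ_c_succ, Φ_R_zero A o' h']
        simp only [allAtOnce_c_o, allAtOnce_c_R]
      · rw [Φ_c_succ, Φ_R_succ A o' h']
        simp only [allAtOnce_c_R]
  · cases j using Fin.cases with
    | zero =>
      cases j' using Fin.cases with
      | zero =>
        rw [Φ_c_zero]
        simp only [allAtOnce_o_o, gB_symm_symm, gadget_c_c, allAtOnce_c_c, bse_inl, if_true]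
      | succ j' =>
        rw [Φ_c_zero, Φ_c_succ]
        simp [allAtOnce_o_c, allAtOnce_c_c, (Fin.succ_ne_zero j').symm]
    | succ j =>
      cases j' using Fin.cases with
      | zero =>
        rw [Φ_c_succ, Φ_c_zero]
        simp [allAtOnce_c_o, allAtOnce_c_c, Fin.succ_ne_zero j]
      | succ j' =>
        rw [Φ_c_succ, Φ_c_succ]
        simp only [allAtOnce_c_c, Fin.succ_inj]

/-- Hence the two all-at-once matrices are re-indexings of each other. [cite: BurgisserClausenShokrollahi1997, Thm. (21.29)] -/
theorem allAtOnce_submatrix_Φ (hA : HasColumnProperty A) :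
    (allAtOnce (gB A)).submatrix (ΦEquiv A hA) (ΦEquiv A hA) = allAtOnce A := by
  ext x y
  simp only [Matrix.submatrix_apply, ΦEquiv_apply, allAtOnce_Φ A hA]

/-- **Bisimulation on the level of permanents**: `per (allAtOnce A) = per (allAtOnce (gB A))`. [cite: BurgisserClausenShokrollahi1997, Thm. (21.29)] -/
theorem perY_allAtOnce_eq_gB (hA : HasColumnProperty A) : perY (allAtOnce A) = perY (allAtOnce (gB A)) := by
  unfold perY
  rw [← allAtOnce_submatrix_Φ A hA, ← Matrix.submatrix_map, Matrix.permanent_submatrix_equiv]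

end Bisim

/-! ### The permanent of the all-at-once matrix -/

section Main

variable [CommRing k]

/-- One elimination step on the level of Boolean substitutions:
`per (gB A)(Y := e) = 16^μ · (per A(Y₀ := 0, Y := e) + per A(Y₀ := 1, Y := e))`. [cite: BurgisserClausenShokrollahi1997, Thm. (21.29)] -/
theorem entryPer_boolSubst_gB {t N : ℕ} (A : Matrix (Fin N) (Fin N) (k ⊕ (σ ⊕ Fin (t + 1))))
    (hμ : 0 < yMult A) (e : Fin t → Bool) :
    entryPer (boolSubst (gB A) e) = C ((16 : k) ^ yMult A) *
      (entryPer (boolSubst (A.map (substFirst 0)) e) + entryPer (boolSubst (A.map (substFirst 1)) e)) := by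
  rw [entryPer_boolSubst, entryPer_gB, permanent_gadgetM A 1 hμ, one_mul, map_mul, map_add,
    ← entryPer_boolSubst, ← entryPer_boolSubst, MvPolynomial.aeval_C, MvPolynomial.algebraMap_eq]

/-- **The permanent of Valiant's all-at-once matrix** (Valiant 1979, Lemma 3.1 / BCS 1997,
Thm. (21.29) with `ε = 1`): if `A` over `k ∪ X ∪ {Y_1,…,Y_t}` has at most one variable per column
and every `Y_j` occurs, then `per (allAtOnce A) = 16^{#Occ A} · ∑_{e ∈ {0,1}^t} per A(Y := e)` in
`k[X]`. [cite: Valiant1979, Lemma 3.1] -/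
theorem perY_allAtOnce : ∀ (t : ℕ) {N : ℕ} (A : Matrix (Fin N) (Fin N) (k ⊕ (σ ⊕ Fin t))),
    HasColumnProperty A → (∀ j : Fin t, ∃ o : Occ A, o.var = j) →
    perY (allAtOnce A) =
      C ((16 : k) ^ Fintype.card (Occ A)) * ∑ e : Fin t → Bool, entryPer (boolSubst A e)
  | 0, N, A, _, _ => by
    haveI : IsEmpty (Occ A) := ⟨fun o => Fin.elim0 o.var⟩
    rw [Fintype.card_eq_zero, pow_zero, C_1, one_mul, Fintype.sum_unique]
    unfold perY entryPer boolSubst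
    rw [← Matrix.permanent_submatrix_equiv
      (Equiv.sumEmpty (Fin N) ((Occ A × (Fin 4 ⊕ Fin 4)) ⊕ Fin 0)).symm]
    congr 1
    ext r s
    simp only [Matrix.submatrix_apply, Matrix.map_apply, Equiv.sumEmpty_symm_apply, allAtOnce_o_o]
    congr 2
    exact congrArg (fun f => boolSubstEntry f (A r s)) (funext fun j => Fin.elim0 j)
  | t + 1, N, A, hA, hocc => by
    have hμ := yMult_pos_of_occ A hocc
    rw [perY_allAtOnce_eq_gB A hA,
      perY_allAtOnce t (gB A) (hasColumnProperty_gB A hA) (occ_gB_of_occ A hocc),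
      card_occ A hA, sum_entryPer_boolSubst_succ A, pow_add, C_mul, Finset.mul_sum, Finset.mul_sum]
    refine Finset.sum_congr rfl fun e _ => ?_
    rw [entryPer_boolSubst_gB A hμ e]
    ring

end Main

end ValiantAll

end Literature.Computability.AlgebraicComplexity
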